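/- Copyright: the b2b-balaban cell (near-miss cell 7), T⁴-continuum fan-out, ROUND-2 swarm `t4-ne7b-formalise-*`
(leaf 08), row NE7b (node U5c COUNT member).  Released under the licence of the surrounding project. -/
import Summits.QuantumFields.BalabanUV.T4Continuum.Support.HistoryRealisePrintCells
import Summits.QuantumFields.BalabanUV.T4Continuum.Support.HistoryRealiseCellsWitness
import Literature.MathematicalPhysics.QuantumFieldTheory.Balaban1983to89.B15Claim177

/-!
# The print-exact predicate is STRICTLY WEAKER, decided: a join realised by `RealisesP` and by NO domain under
`Realises`; and the print-exact carriers are inhabited (row S1b-P2 «print-exact carriers», part 5 — sanity companion)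

Summits-side support leaf of the T⁴-continuum cell (rung (B)+1 on a FINITE torus only; NOT infinite volume, NOT the
mass gap, NOT the Clay statement; NOT a proof of the spine estimate NE7b, which is the cell's OWN estimate, NOT PRINTED
and NOT PROVED).  Row S1b-P2 (R-OWNER-40-2, `CLAIMS.log` l.26158; claim l.26451), custodian lineage leaf-08.

WHY.  The owner's located MODEL finding F-ne7bp1g40-1 says row S1b's `Realises` asks one index too many of a join
partner (pendency THROUGH the join scale), the print-exact clause being `PendingBefore` (B16 p. 387's partner with
`K₁ = 0`: ready exactly at the merge scale).  The core `HistoryRealisePrint` (p246311) records the boundary case only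
ABSTRACTLY (`PendingBefore ∧ ¬PendingAt` with `Stops` a hypothesis, «no geometry is decided here»).  THIS FILE DECIDES
IT IN THE `ℤ¹` INDEX MODEL: with `L = 4`, constant exponents (`ratio = 4`) and memory `R ≡ 1`, the unit region `{50}`
born at step `1` is READY EXACTLY AT SCALE `2` (its S-image `S₄{50} ⊇ [2, 22]` fits in 100 cubes and one clean step has
elapsed), and the new region `{23}` born at step `2` TOUCHES that image (`22 ∼ 23`); the join of the two at step `2` is
`RealisesP`-realised (by `{23}`, and by any domain inside the union) but `Realises`-realised by NO domain — so
`realisesP_of_realises` is not invertible, the twin chain R-40-a is not cosmetic, and the core's main theorem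
`exists_stop_lt_reach_P` FIRES on a history outside the landed predicate's range.  §2: the print-exact domain carrier
`RealisedDomainsP` is INHABITED (this lineage's `HistoryRealiseCellsWitness.realisedDomains_toy` through `.toP`).
[folklore] model data; nothing of Bałaban's constructed, nothing printed asserted, no `[cite:]`, no `def … : Prop`,
zero `sorry`.

WHAT.  §1 `s0`, `R1`, `X50`, `N23`, `J` (the data); `box_zero`, `coarse4_pt50`, `pt22_mem_Sop`, `stops_X50`,
**`realisesP_J`**, **`not_realises_J`**, `pendingBefore_not_pendingAt_X50`, `exists_stop_J` (the core's main theorem by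
name on `J`).  §2 `realisedDomainsP_toy`, `realisedReadingP_toy`.

HONEST.  Sanity only; by-name class of every `WALL-NE7b-P1.md` §2 binder UNCHANGED; NE7b NOT proved; spine 0∕9.  HONEST
DEPENDENCY (cell): continuum YM on T⁴ ⇐ BetaPertH ∧ nine spine estimates (0/9 proved); BetaPertH ⇐ (D1) ∧ (D4) ∧ CAP+tail;
G-an2-4 gates asym, D1 and NE2/3/4.  This file changes none of it. -/

open Finset
open Literature.MathematicalPhysics.QuantumFieldTheory.Balaban1983to89
open Literature.MathematicalPhysics.QuantumFieldTheory.Balaban1983to89.B13ScaleTransfer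
open Literature.MathematicalPhysics.QuantumFieldTheory.Balaban1983to89.TreeLength
open Literature.MathematicalPhysics.QuantumFieldTheory.Balaban1983to89.B16SProfile
open Literature.MathematicalPhysics.QuantumFieldTheory.Balaban1983to89.B16StoppingRule
open Literature.MathematicalPhysics.QuantumFieldTheory.Balaban1983to89.B16MergeGeometry
open Literature.MathematicalPhysics.QuantumFieldTheory.Balaban1983to89.B16Absorption
open Literature.MathematicalPhysics.QuantumFieldTheory.Balaban1983to89.B16MergeGeometry.OneDim
open Literature.MathematicalPhysics.QuantumFieldTheory.Balaban1983to89.B15Claim177 (box_subset_Sop_box)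
open T4PersistenceDictionary
open Summit.QuantumFields.BalabanUV.T4Continuum.HistoryAdmissible
open Summit.QuantumFields.BalabanUV.T4Continuum.HistoryAdmissible.PGen
open Summit.QuantumFields.BalabanUV.T4Continuum.HistoryWindows
open Summit.QuantumFields.BalabanUV.T4Continuum.HistoryRealise
open Summit.QuantumFields.BalabanUV.T4Continuum.HistoryRealisePrint
open Summit.QuantumFields.BalabanUV.T4Continuum.HistoryRealisePrintReading
open Summit.QuantumFields.BalabanUV.T4Continuum.HistoryRealisePrintCells
open Summit.QuantumFields.BalabanUV.T4Continuum.HistoryRealiseCells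

namespace Summit.QuantumFields.BalabanUV.T4Continuum.HistoryRealisePrintWitness

noncomputable section

/-! ## §1 A join realised print-exactly and by no domain under the landed predicate -/

/-- constant exponents: every step re-blocks by `L` [folklore] -/
def s0 : ℕ → ℕ := fun _ => 0

/-- memory one: a region is ready one clean scale after its birth [folklore] -/
def R1 : ℕ → ℕ := fun _ => 1

/-- the old partner: the unit region `{50}` born at step `1` [folklore] -/
def X50 : PGen (Pt 1 × Finset (Pt 1)) := PGen.birth 1 0 (pt 50, {pt 50})

/-- the new region `{23}` born at step `2` [folklore] -/
def N23 : PGen (Pt 1 × Finset (Pt 1)) := PGen.birth 2 0 (pt 23, {pt 23})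

/-- the join of the two at step `2` [folklore] -/
def J : PGen (Pt 1 × Finset (Pt 1)) := PGen.join X50 N23 2

/-- the ratio of the constant profile is `L` [folklore] -/
theorem ratio_s0 (L i : ℕ) (t : ℕ) : ratio L (fun j => s0 (t + j)) i = L := by
  simp [ratio, qexp, s0]

/-- a radius-`0` box is the singleton [folklore] -/
theorem box_zero (c : Pt 1) : box c 0 = {c} := by
  ext y
  simp only [mem_box, Nat.cast_zero, sub_zero, add_zero, Finset.mem_singleton]
  constructor
  · intro h; funext i; have := h i; omega
  · rintro rfl i; exact ⟨le_rfl, le_rfl⟩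

/-- the coarse cube of `50` at ratio `4` is `12` [folklore] -/
theorem coarse4_pt50 : coarse 4 (pt 50) = pt 12 := by
  funext i; simp [coarse]

/-- `22 ∈ S₄{50}` (the image `S₄{50}` contains the box `[2, 22]` about the coarse cube `12`) [folklore] -/
theorem pt22_mem_Sop : pt 22 ∈ Sop 4 ({pt 50} : Finset (Pt 1)) := by
  have h := box_subset_Sop_box (d := 1) (q := 4) (by norm_num) (pt 50) 0
  rw [coarse4_pt50, box_zero, Nat.zero_div, Nat.zero_add] at h
  exact h (mem_box.2 fun i => by simp [pt])

/-- a unit region is realised by itself, in both predicates [folklore] -/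
theorem realises_unit (L : ℕ) (s R : ℕ → ℕ) (j : ℕ) (k : ℤ) :
    Realises L s R (PGen.birth j 0 (pt k, ({pt k} : Finset (Pt 1)))) {pt k} :=
  ⟨rfl, mem_singleton_self _, by rw [← row_zero]; exact faceConnected_row _ 0, by rw [treeLen_singleton]; simp⟩

/-- **THE OLD PARTNER IS READY EXACTLY AT SCALE `2`**: `Stops 4 s0 R1 1 {50} 1` — condition (i) for `S₄{50}` (boxed
with width `20`) and the one clean step of memory `R1 1 = 1`. [folklore] -/
theorem stops_X50 : Stops 4 s0 R1 1 ({pt 50} : Finset (Pt 1)) 1 := by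
  have hI : ∀ l, 0 < l → l ≤ 1 → CondI 100 (orbit 4 s0 1 ({pt 50} : Finset (Pt 1)) l) := by
    intro l h1 h2
    obtain rfl : l = 1 := by omega
    rw [orbit_succ, orbit_zero]
    apply condI_of_boxed
    have hb : Boxed 0 ({pt 50} : Finset (Pt 1)) :=
      ⟨pt 50, pt 50, fun y hy => by rw [Finset.mem_singleton] at hy; subst hy; exact mem_pbox.2 fun i => ⟨le_rfl, le_rfl⟩,
        fun i => by simp⟩
    exact (hb.sop (ratio_pos (by norm_num) _ 0)).mono (by simp [cdiv])
  show 0 < 1 ∧ CondI 100 _ ∧ (R1 1 ≤ 1 ∧ ∀ l, 1 < l + R1 1 → l ≤ 1 → True ∧ CondI 100 (orbit 4 s0 1 {pt 50} l))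
  simp only [R1]
  exact ⟨Nat.one_pos, hI 1 Nat.one_pos le_rfl, le_rfl, fun l h1 h2 => ⟨trivial, hI l (by omega) h2⟩⟩

/-- hence it is pending STRICTLY BEFORE scale `2` but NOT THROUGH it — the finding's boundary case, DECIDED [folklore] -/
theorem pendingBefore_not_pendingAt_X50 :
    PendingBefore 4 s0 R1 1 ({pt 50} : Finset (Pt 1)) 2 ∧ ¬ PendingAt 4 s0 R1 1 ({pt 50} : Finset (Pt 1)) 2 :=
  ⟨pendingBefore_succ_self 4 s0 R1 1 _, fun h => h.2 1 (by norm_num) stops_X50⟩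

/-- **THE JOIN IS PRINT-EXACTLY REALISED** by the new region `{23}` (and by any domain inside `S₄{50} ∪ {23}`): both
partners pending STRICTLY BEFORE `2`, images `S₄{50} ∋ 22` and `{23}` touching. [folklore] -/
theorem realisesP_J : RealisesP 4 s0 R1 J {pt 23} := by
  refine ⟨{pt 50}, {pt 23}, realisesP_of_realises _ _ (realises_unit 4 s0 R1 1 50),
    realisesP_of_realises _ _ (realises_unit 4 s0 R1 2 23), by decide, le_rfl,
    pendingBefore_not_pendingAt_X50.1, ⟨le_rfl, fun k hk => by simp [N23, lastStep] at hk⟩, ⟨pt 22, ?_, pt 23, ?_, ?_⟩, ?_⟩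
  · show pt 22 ∈ orbit 4 s0 1 {pt 50} (2 - 1)
    rw [show (2 : ℕ) - 1 = 0 + 1 from rfl, orbit_succ, orbit_zero, ratio_s0]
    exact pt22_mem_Sop
  · show pt 23 ∈ orbit 4 s0 2 {pt 23} (2 - 2)
    simp
  · intro i; simp only [pt_apply]; omega
  · intro x hx
    rw [Finset.mem_singleton] at hx
    subst hx
    apply Finset.mem_union_right
    show pt 23 ∈ orbit 4 s0 2 {pt 23} (2 - 2)
    simp

/-- **… AND REALISED BY NO DOMAIN UNDER THE LANDED PREDICATE**: `Realises` would ask the old partner to be pending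
THROUGH scale `2`, contradicting `stops_X50`. [folklore] -/
theorem not_realises_J (Z : Finset (Pt 1)) : ¬ Realises 4 s0 R1 J Z := by
  rintro ⟨ZX, ZY, hX, -, -, -, hpX, -, -, -⟩
  obtain ⟨hZX, -, -, -⟩ := hX
  have hZX' : ZX = {pt 50} := by simpa [X50] using hZX.symm
  subst hZX'
  exact hpX.2 1 (by simp [X50, lastStep]) stops_X50

/-- so `realisesP_of_realises` is NOT invertible: the print-exact predicate is strictly weaker [folklore] -/
theorem realisesP_strictly_weaker :
    ∃ (P : PGen (Pt 1 × Finset (Pt 1))) (Z : Finset (Pt 1)), RealisesP 4 s0 R1 P Z ∧ ∀ Z', ¬ Realises 4 s0 R1 P Z' :=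
  ⟨J, {pt 23}, realisesP_J, not_realises_J⟩

/-- **THE CORE'S MAIN THEOREM FIRES ON THE BOUNDARY HISTORY** (allowance `n₁ = 13`): the join stops at some `k ≥ 1`
strictly inside its booked life — a non-vacuous instance of `exists_stop_lt_reach_P` outside `Realises`' range.
[folklore] -/
theorem exists_stop_J : ∃ k, 1 ≤ k ∧ Stops 4 s0 R1 J.lastStep {pt 23} k ∧ J.lastStep + k < J.toGen.reach (dictW R1 13) :=
  exists_stop_lt_reach_P (L := 4) le_rfl (fun m => dropCtl_const 0 m) (fun _ => le_rfl) (n₁ := 13) le_rfl J _ realisesP_J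

/-! ## §2 The print-exact domain carrier is inhabited -/

open HistoryRealiseCellsWitness in
/-- this lineage's decided `RealisedDomains` toy (two unit regions, one term at cutoff `0`) gives a `RealisedDomainsP`
instance through `HistoryRealisePrintCells.RealisedDomains.toP` [folklore] -/
theorem realisedDomainsP_toy : RealisedDomainsP 4 (fun _ => 0) 100 0 RR TW pedR cellPR liveR ZR :=
  RealisedDomains.toP realisedDomains_toy

open HistoryRealiseCellsWitness in
/-- … hence a `RealisedReadingP` with DEFINED root cells (constant exponents are drop-controlled and non-increasing)
[folklore] -/
theorem realisedReadingP_toy :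
    RealisedReadingP 4 (fun _ => 0) (HistoryTables.cellN 1 100 4) 0 RR TW pedR cellPR liveR
      (cellOfA 100 4 (fun _ => 0) pedR cellPR) :=
  realisedReadingP_of_domainsP (by norm_num) (by norm_num) (fun _ => le_rfl) (fun m => dropCtl_const 0 m)
    realisedDomainsP_toy

end

end Summit.QuantumFields.BalabanUV.T4Continuum.HistoryRealisePrintWitness
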